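import Summits.MatrixMultiplication.MatrixMultiplication.Theses.StabilizerTensorRank
import Summits.MatrixMultiplication.MatrixMultiplication.Theorems.StabilizerTensorRankStabKronecker

/-!
# The decomposition of `OmegaStabTwo` is EXACT (documentation of the census claim; evidence only)

Both leaves are CONSEQUENCES of the deciding crux (so the decomposition
`OmegaStabTwo ⟸ StabBeatsStrassen ∧ StabDefectContraction` loses nothing):

* `stabBeatsStrassen_of_omegaStabTwo : OmegaStabTwo → StabBeatsStrassen` — at `ε = 1/2`,
  `r ≤ 2^(5k/2) < 7^k` (`2^(5/2) < 7`, i.e. `32 < 49`).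
* `stabDefectContraction_of_omegaStabTwo : OmegaStabTwo → (the step)` — given an input `(k, r)` with
  defect `D = r/4^k`: if `D = 1` its own Kronecker powers do (`hasStabilizerScheme_pow`); if `D > 1` pick
  `ε ≤ (1/2)·log₂ D / k`... here simply `ε` with `2^(ε k) ≤ D^(1/2)`, take the near-optimal scale `K` of
  `OmegaStabTwo` at that `ε` and the `k`-th Kronecker power of its scheme: scale `k·K = K·k`, size
  `R^k ≤ 2^((2+ε)K k) = 4^(kK) · (2^(εk))^K ≤ 4^(kK) · D^(K/2) = r^K / D^(K/2)`, i.e. the step holds with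
  rate `c = 1/2` and `m = K`.

Not meant to be landed as is (it would add `X → leaf` edges to the route's cone); it backs the line
card / STRATEGY-CENSUS statement "both pieces are strictly-weaker consequences of X; neither gives X
alone".
-/

set_option linter.dupNamespace false

noncomputable section

open scoped BigOperators

namespace Summit.MatrixMultiplication.MatrixMultiplication.Cruxes.OmegaStabTwo.Exactness

open Literature.Computability.AlgebraicComplexity Literature.Computability.QuantumComplexity
open Summit.MatrixMultiplication.MatrixMultiplication.Theses.StabilizerTensorRank
open Summit.MatrixMultiplication.MatrixMultiplication.Theorems

/-- Kronecker powers inside the model: `HasStabilizerScheme k r → HasStabilizerScheme (t k) (r^t)`.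
[folklore] -/
theorem hasStabilizerScheme_pow {k r : ℕ} (h : HasStabilizerScheme k r) :
    ∀ t : ℕ, 1 ≤ t → HasStabilizerScheme (t * k) (r ^ t) := by
  intro t ht
  induction t with
  | zero => omega
  | succ t ih =>
      rcases Nat.eq_zero_or_pos t with rfl | hpos
      · simpa using h
      · have h' := hasStabilizerScheme_mul (ih hpos) h
        have e1 : t * k + k = (t + 1) * k := by ring
        have e2 : r ^ t * r = r ^ (t + 1) := by ring
        rw [e1, e2] at h'
        exact h'

/-- `4^k ≤ r` for every stabilizer scheme (flattening). [folklore] -/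
theorem four_pow_le {k r : ℕ} (h : HasStabilizerScheme k r) : 4 ^ k ≤ r := by
  have h1 := matMulTensor_sq_le_tensorRank ℂ (2 ^ k)
  have h2 := (tensorRank_le_stabTensorRank k).trans (stabTensorRank_le_of_hasStabilizerScheme h)
  have h3 : (2 ^ k) ^ 2 = 4 ^ k := by
    rw [← pow_mul, mul_comm, pow_mul]
    norm_num
  calc 4 ^ k = (2 ^ k) ^ 2 := h3.symm
    _ ≤ _ := h1.trans h2

/-- **The seed is a consequence of the crux**: `OmegaStabTwo → StabBeatsStrassen`. [folklore] -/
theorem stabBeatsStrassen_of_omegaStabTwo (hX : OmegaStabTwo) : StabBeatsStrassen := by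
  obtain ⟨k, hk, r, hr, hS⟩ := hX (1 / 2) (by norm_num)
  refine ⟨k, r, ?_, hS⟩
  -- r ≤ 2^((5/2) k) < 7^k
  have hkpos : (0 : ℝ) < k := by exact_mod_cast hk
  have hlt : (2 : ℝ) ^ ((2 + 1 / 2) * (k : ℝ)) < (7 : ℝ) ^ k := by
    have h32 : (2 : ℝ) ^ ((2 + 1 / 2) * (k : ℝ)) = ((2 : ℝ) ^ ((5 : ℝ) / 2)) ^ (k : ℝ) := by
      rw [← Real.rpow_mul (by norm_num : (0 : ℝ) ≤ 2)]
      norm_num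
    have hbase : (2 : ℝ) ^ ((5 : ℝ) / 2) < 7 := by
      have h : ((2 : ℝ) ^ ((5 : ℝ) / 2)) ^ (2 : ℕ) = 32 := by
        rw [← Real.rpow_natCast, ← Real.rpow_mul (by norm_num : (0 : ℝ) ≤ 2)]
        norm_num
      have hnn : 0 ≤ (2 : ℝ) ^ ((5 : ℝ) / 2) := Real.rpow_nonneg (by norm_num) _
      nlinarith [h, hnn]
    rw [h32, ← Real.rpow_natCast (7 : ℝ) k]
    exact Real.rpow_lt_rpow (Real.rpow_nonneg (by norm_num) _) hbase hkpos
  exact_mod_cast (hr.trans_lt hlt)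

/-- **The step is a consequence of the crux**: `OmegaStabTwo →` uniform defect contraction below the
Strassen frame (with rate `c = 1/2`). [folklore] -/
theorem stabDefectContraction_of_omegaStabTwo (hX : OmegaStabTwo) :
    ∃ c : ℝ, 0 < c ∧ ∀ k r : ℕ, 1 ≤ k → r < 7 ^ k → HasStabilizerScheme k r →
      ∃ m r' : ℕ, 1 ≤ m ∧ HasStabilizerScheme (m * k) r' ∧
        (r' : ℝ) * ((r : ℝ) / 4 ^ k) ^ (c * m) ≤ (r : ℝ) ^ m := by
  refine ⟨1 / 2, by norm_num, fun k r hk _ hS => ?_⟩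
  have h4 := four_pow_le hS
  have hkpos : (0 : ℝ) < k := by exact_mod_cast hk
  have h4pos : (0 : ℝ) < (4 : ℝ) ^ k := by positivity
  have h4r : (4 : ℝ) ^ k ≤ r := by exact_mod_cast h4
  have hrpos : (0 : ℝ) < r := h4pos.trans_le h4r
  set D : ℝ := (r : ℝ) / 4 ^ k with hD_def
  have hD1 : 1 ≤ D := by
    rw [hD_def, le_div_iff₀ h4pos, one_mul]
    exact h4r
  have hDpos : 0 < D := one_pos.trans_le hD1
  rcases hD1.eq_or_lt with hDeq | hDgt
  · -- D = 1: the input's own first power does (m = 1, r' = r)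
    refine ⟨1, r, le_rfl, by simpa using hS, ?_⟩
    rw [← hDeq]
    simp
  · -- D > 1: a near-optimal scale K of the crux, Kronecker-powered k times
    -- choose ε with 2^(ε k) ≤ D^(1/2): ε := log D / (2 k log 2)
    have hlog2 : 0 < Real.log 2 := Real.log_pos one_lt_two
    have hlogD : 0 < Real.log D := Real.log_pos hDgt
    set ε : ℝ := Real.log D / (2 * k * Real.log 2) with hε_def
    have hε : 0 < ε := by positivity
    obtain ⟨K, hK, R, hR, hSK⟩ := hX ε hε
    have hSK' : HasStabilizerScheme K R := hSK
    -- the k-th Kronecker power of the K-scheme: scale k K, size R^k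
    have hpow := hasStabilizerScheme_pow hSK' k hk
    refine ⟨K, R ^ k, hK, ?_, ?_⟩
    · have e : k * K = K * k := mul_comm _ _
      rw [e] at hpow
      exact hpow
    · -- (R^k) · D^(K/2) ≤ r^K, via logs
      have hRpos : (0 : ℝ) < R := by
        have := four_pow_le hSK'
        have h4K : (0 : ℝ) < (4 : ℝ) ^ K := by positivity
        exact h4K.trans_le (by exact_mod_cast this)
      have hKpos : (0 : ℝ) < K := by exact_mod_cast hK
      -- log R ≤ (2 + ε) K log 2
      have hlogR : Real.log R ≤ (2 + ε) * K * Real.log 2 := by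
        have := Real.log_le_log hRpos hR
        rwa [Real.log_rpow two_pos] at this
      -- log r = log D + k log 4, log 4 = 2 log 2
      have hlog4 : Real.log 4 = 2 * Real.log 2 := by
        rw [show (4 : ℝ) = 2 ^ 2 by norm_num, Real.log_pow]; norm_num
      have hlogr : Real.log r = Real.log D + k * (2 * Real.log 2) := by
        rw [hD_def, Real.log_div hrpos.ne' h4pos.ne', Real.log_pow, hlog4]; ring
      -- ε k log 2 = log D / 2
      have hεk : ε * k * Real.log 2 = Real.log D / 2 := by
        rw [hε_def]; field_simp
      -- take logs of the goal
      have hpos1 : (0 : ℝ) < (R : ℝ) ^ k * D ^ ((1 : ℝ) / 2 * K) := by positivity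
      rw [show ((R ^ k : ℕ) : ℝ) = (R : ℝ) ^ k by push_cast; ring]
      rw [← Real.log_le_log_iff hpos1 (by positivity)]
      rw [Real.log_mul (by positivity) (by positivity), Real.log_pow, Real.log_rpow hDpos,
        Real.log_pow, hlogr]
      -- k log R + (K/2) log D ≤ K (log D + 2 k log 2)
      have : (k : ℝ) * Real.log R ≤ k * ((2 + ε) * K * Real.log 2) :=
        mul_le_mul_of_nonneg_left hlogR (Nat.cast_nonneg k)
      nlinarith [this, hεk, hlogD, hKpos, hkpos, hlog2]

end Summit.MatrixMultiplication.MatrixMultiplication.Cruxes.OmegaStabTwo.Exactness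

end
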